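import Summits.HodgeConjecture.HodgeConjecture.Theorems.Ring2WeilCoverageNormCriteria
import HarnessLib

/-!
# Weil-type family coverage — the Schur-index-ONE window REDUCED: septic Jacobians and `η`-factors (ring2-b02, gen 59)

research route conditional on HC_CM; not a corollary; Q11.4-sentence-2 already refuted in dim ≥ 3.

Ring 2, WEIL-TYPE FAMILY-COVERAGE CENSUS (`HOME/WEIL-FAMILY-COVERAGE.md` `## b02 (g = 6)`, block b02.19, owner ring2-b02).
THEOREM R of that block (isotypic reduction; Lange–Rodríguez, *Decomposition of Jacobians by Prym varieties* (2022)
Ch. 1 / Cor. 3.5.10; Ellenberg, Adv. Math. 162 (2001) §1): for a finite group `G` and an absolutely irreducible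
character `χ` of degree `d` with `ℚ(χ) = K = ℚ(√-q)` and Schur index one, the `(χ + χ̄)`-isotypic piece `P` of a
`G`-curve is `P ~ B^d` with `B = e₁₁P`, `K ⊂ End⁰(B)`, `K`-signature `sig(P)/d` and — for `d` odd — the same
discriminant class `[a_B] = [a_P] ∈ ℚˣ/Nm(Kˣ)`.  For `G = F₂₁ = C₇ ⋊ C₃` (`d = 3`, `K = ℚ(√-7)`) the factor is the
SEPTIC JACOBIAN `B ~ J(C̃/C₃)` (base `ℙ¹`; the Prym `P(D/C)` in general).  The census engine `smono.py` (exact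
rational arithmetic; Fox/fatgraph model of `H₁`, Morita-reduced to `K³`-rows; van Geemen's `H = S + θE`) computed,
for nineteen `F₂₁` / `PSL₂(𝔽₇)` branch data, the literal `det H_B` on its basis and the algebraic monodromy of the
family.  THIS FILE pins the arithmetic half: every `det H_B` met lies in the SPLIT class
`splitDiscriminantClass n 7 = [(-1)ⁿ]` (`2n = dim_K H₁(B;ℚ) = dim B`, here `n ∈ {1, 2, 3}`), by an explicit representation `a = x² + 7y²` of `a = (-1)ⁿ det H_B`
(`mem_normUnitsSubgroup_of_sq_add_mul_sq`, `mk_eq_splitDiscriminantClass_iff_of_even`,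
`mk_neg_eq_splitDiscriminantClass_iff_of_odd` of `Ring2WeilCoverageNormCriteria`).  So the genus-6 septic
Jacobians / Pryms are members of the component `(3, ℚ(√-7), [−1])` = row W6.7.1, the genus-4 ones of
`(2, ℚ(√-7), [1])` = W4.7.1; the monodromy statements (Zariski density in `SU(3,3)` / `SU(2,2)`, hence
`End⁰ = ℚ(√-7)` for the very general member) are the census's (exact computation), not the kernel's.

No `def`, no named fact, no `sorry`; nothing here is a statement about Hodge classes; `HC_CM` is used nowhere.

References: [cite: vanGeemen1994HodgeAV, 5.2 and (5.4.1)].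
-/

noncomputable section

set_option linter.dupNamespace false

open Literature.AlgebraicGeometry.Motives
open Literature.AlgebraicGeometry.VanGeemen1994
open Summit.HodgeConjecture.HodgeConjecture.Ring2.Hypotheses

namespace Summit.HodgeConjecture.HodgeConjecture.Ring2.WeilCoverage

/-- **the genus-6 septic Jacobians `J(D_t)`, `D_t = C̃_t/C₃` for the `F₂₁`-covers of `ℙ¹` of type `(0; 3,3,3,7,7′)` (genus 19; one braid orbit of 8820 tuples; 2-parameter family): `K`-signature `(3,3)`, `det H = −3779136/16807 = −7·(1944/343)²`, `a = 7·(1944/343)² = 0² + 7·(1944/343)²` — row `W6.7.1` (split). Monodromy Zariski-dense in `SU(3,3)` (Lie dimension 35/35), so the very general member has `Hg = SU(3,3)`, `End⁰ = ℚ(√-7)`.**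
research route conditional on HC_CM; not a corollary; Q11.4-sentence-2 already refuted in dim ≥ 3. [cite: vanGeemen1994HodgeAV, (5.4.1)] -/
theorem septicJacobian_f21_33377_mk_detH_eq_split :
    (QuotientGroup.mk (Units.mk0 ((-3779136 : ℚ) / 16807) (by norm_num)) : weilNormResidueGroup 7) =
      splitDiscriminantClass 3 7 := by
  have e : Units.mk0 ((-3779136 : ℚ) / 16807) (by norm_num) = -(Units.mk0 ((3779136 : ℚ) / 16807) (by norm_num)) :=
    Units.ext (by norm_num)
  rw [e, mk_neg_eq_splitDiscriminantClass_iff_of_odd (n := 3) (by decide)]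
  exact mem_normUnitsSubgroup_of_sq_add_mul_sq _ (0 : ℚ) ((1944 : ℚ) / 343) (by norm_num)

/-- **the Pryms `P(D_t/E_t)` (`dim 6`, `g(D_t) = 7`) of the septic `F₂₁`-covers of elliptic curves of type `(1; 7,7′)` (genus 19; one orbit of 1008 tuples; 2 parameters): `K`-signature `(3,3)`, `det H = −49/128`, `a = 49/128 = (7/32)² + 7·(7/32)²` — row `W6.7.1` (split); `SU(3,3)` dense (35/35).**
research route conditional on HC_CM; not a corollary; Q11.4-sentence-2 already refuted in dim ≥ 3. [cite: vanGeemen1994HodgeAV, (5.4.1)] -/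
theorem septicPrym_f21_g1_77_mk_detH_eq_split :
    (QuotientGroup.mk (Units.mk0 ((-49 : ℚ) / 128) (by norm_num)) : weilNormResidueGroup 7) =
      splitDiscriminantClass 3 7 := by
  have e : Units.mk0 ((-49 : ℚ) / 128) (by norm_num) = -(Units.mk0 ((49 : ℚ) / 128) (by norm_num)) :=
    Units.ext (by norm_num)
  rw [e, mk_neg_eq_splitDiscriminantClass_iff_of_odd (n := 3) (by decide)]
  exact mem_normUnitsSubgroup_of_sq_add_mul_sq _ ((7 : ℚ) / 32) ((7 : ℚ) / 32) (by norm_num)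

/-- **the genus-6 septic Jacobians over `(0; 3A,3A,3A,3B,3B,3B)` (genus 22; one orbit of 336000 tuples; 3-parameter family): `K`-signature `(3,3)`, `det H = −7558272/117649`, `a = 2·(1944/343)² = (972/343)² + 7·(972/343)²` — row `W6.7.1` (split); `SU(3,3)` dense (35/35).**
research route conditional on HC_CM; not a corollary; Q11.4-sentence-2 already refuted in dim ≥ 3. [cite: vanGeemen1994HodgeAV, (5.4.1)] -/
theorem septicJacobian_f21_3A3_3B3_mk_detH_eq_split :
    (QuotientGroup.mk (Units.mk0 ((-7558272 : ℚ) / 117649) (by norm_num)) : weilNormResidueGroup 7) =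
      splitDiscriminantClass 3 7 := by
  have e : Units.mk0 ((-7558272 : ℚ) / 117649) (by norm_num) = -(Units.mk0 ((7558272 : ℚ) / 117649) (by norm_num)) :=
    Units.ext (by norm_num)
  rw [e, mk_neg_eq_splitDiscriminantClass_iff_of_odd (n := 3) (by decide)]
  exact mem_normUnitsSubgroup_of_sq_add_mul_sq _ ((972 : ℚ) / 343) ((972 : ℚ) / 343) (by norm_num)

/-- **the genus-6 septic Jacobians over `(0; 3A,3A,3A,3A,3A,3A)` (genus 22; one orbit of 16800 tuples; 3 parameters): `K`-signature `(3,3)` (Weil type although all order-3 points lie in ONE class), `det H = −30233088/117649`, `a = 8·(1944/343)² = (1944/343)² + 7·(1944/343)²` — row `W6.7.1` (split); `SU(3,3)` dense (35/35).**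
research route conditional on HC_CM; not a corollary; Q11.4-sentence-2 already refuted in dim ≥ 3. [cite: vanGeemen1994HodgeAV, (5.4.1)] -/
theorem septicJacobian_f21_3A6_mk_detH_eq_split :
    (QuotientGroup.mk (Units.mk0 ((-30233088 : ℚ) / 117649) (by norm_num)) : weilNormResidueGroup 7) =
      splitDiscriminantClass 3 7 := by
  have e : Units.mk0 ((-30233088 : ℚ) / 117649) (by norm_num) = -(Units.mk0 ((30233088 : ℚ) / 117649) (by norm_num)) :=
    Units.ext (by norm_num)
  rw [e, mk_neg_eq_splitDiscriminantClass_iff_of_odd (n := 3) (by decide)]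
  exact mem_normUnitsSubgroup_of_sq_add_mul_sq _ ((1944 : ℚ) / 343) ((1944 : ℚ) / 343) (by norm_num)

/-- **the Pryms `P(D_t/E_t)` (`dim 6`, `g(D_t) = 7`) over `(1; 3A,3A,3A)` (genus 22; one orbit of 21546 tuples; 3 parameters): `K`-signature `(3,3)`, `det H = −1/16807 = −1/7⁵`, `a = 0² + 7·(1/343)²` — row `W6.7.1` (split); `SU(3,3)` dense (35/35).**
research route conditional on HC_CM; not a corollary; Q11.4-sentence-2 already refuted in dim ≥ 3. [cite: vanGeemen1994HodgeAV, (5.4.1)] -/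
theorem septicPrym_f21_g1_3A3_mk_detH_eq_split :
    (QuotientGroup.mk (Units.mk0 ((-1 : ℚ) / 16807) (by norm_num)) : weilNormResidueGroup 7) =
      splitDiscriminantClass 3 7 := by
  have e : Units.mk0 ((-1 : ℚ) / 16807) (by norm_num) = -(Units.mk0 ((1 : ℚ) / 16807) (by norm_num)) :=
    Units.ext (by norm_num)
  rw [e, mk_neg_eq_splitDiscriminantClass_iff_of_odd (n := 3) (by decide)]
  exact mem_normUnitsSubgroup_of_sq_add_mul_sq _ (0 : ℚ) ((1 : ℚ) / 343) (by norm_num)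

/-- **the `η`-factor `B_t = e₁₁P_t` (`dim 6`) of the `PSL₂(𝔽₇)`-covers `(0; 7,7,7′,7′)` (genus 121; two braid orbits, 8064 + 14112 tuples; 1 parameter): `K`-signature `(3,3)` on both, `det H = −729/9834496 = −(27/3136)²`, `a = (27/3136)² + 7·0²` — row `W6.7.1` (split); orbit 1: `SU(3,3)` dense (35/35); orbit 2: `𝔰𝔭₄ ⊕ 𝔰𝔲(1,1)` (13/35), `B_t ~ S_t² × E_t²`.**
research route conditional on HC_CM; not a corollary; Q11.4-sentence-2 already refuted in dim ≥ 3. [cite: vanGeemen1994HodgeAV, (5.4.1)] -/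
theorem sixfold_psl27_7777_mk_detH_eq_split :
    (QuotientGroup.mk (Units.mk0 ((-729 : ℚ) / 9834496) (by norm_num)) : weilNormResidueGroup 7) =
      splitDiscriminantClass 3 7 := by
  have e : Units.mk0 ((-729 : ℚ) / 9834496) (by norm_num) = -(Units.mk0 ((729 : ℚ) / 9834496) (by norm_num)) :=
    Units.ext (by norm_num)
  rw [e, mk_neg_eq_splitDiscriminantClass_iff_of_odd (n := 3) (by decide)]
  exact mem_normUnitsSubgroup_of_sq_add_mul_sq _ ((27 : ℚ) / 3136) (0 : ℚ) (by norm_num)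

/-- **the `η`-factor `B_t` (`dim 6`) of the `PSL₂(𝔽₇)`-covers `(0; 2,2,2,7,7′)` (genus 103; 2 parameters): `K`-signature `(3,3)`, `det H = −729/19668992`, `a = (27/12544)² + 7·(27/12544)²` — row `W6.7.1` (split); `SU(3,3)` dense (35/35) on the explored part of the orbit.**
research route conditional on HC_CM; not a corollary; Q11.4-sentence-2 already refuted in dim ≥ 3. [cite: vanGeemen1994HodgeAV, (5.4.1)] -/
theorem sixfold_psl27_22277_mk_detH_eq_split :
    (QuotientGroup.mk (Units.mk0 ((-729 : ℚ) / 19668992) (by norm_num)) : weilNormResidueGroup 7) =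
      splitDiscriminantClass 3 7 := by
  have e : Units.mk0 ((-729 : ℚ) / 19668992) (by norm_num) = -(Units.mk0 ((729 : ℚ) / 19668992) (by norm_num)) :=
    Units.ext (by norm_num)
  rw [e, mk_neg_eq_splitDiscriminantClass_iff_of_odd (n := 3) (by decide)]
  exact mem_normUnitsSubgroup_of_sq_add_mul_sq _ ((27 : ℚ) / 12544) ((27 : ℚ) / 12544) (by norm_num)

/-- **the genus-4 septic Jacobians `J(D_t)` over `(0; 3,3′,7,7′)` (genus 12; one orbit of 1512 tuples; 1 parameter): `K`-signature `(2,2)`, `det H = 11664/343 = 7·(108/49)²` — row `W4.7.1` (split); `SU(2,2)` dense (15/15): a one-parameter family of genus-4 JACOBIANS whose very general member is a general abelian fourfold of Weil type over `ℚ(√-7)`.**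
research route conditional on HC_CM; not a corollary; Q11.4-sentence-2 already refuted in dim ≥ 3. [cite: vanGeemen1994HodgeAV, (5.4.1)] -/
theorem septicJacobian_f21_3377_mk_detH_eq_split :
    (QuotientGroup.mk (Units.mk0 ((11664 : ℚ) / 343) (by norm_num)) : weilNormResidueGroup 7) =
      splitDiscriminantClass 2 7 := by
  rw [mk_eq_splitDiscriminantClass_iff_of_even (n := 2) (by decide)]
  exact mem_normUnitsSubgroup_of_sq_add_mul_sq _ (0 : ℚ) ((108 : ℚ) / 49) (by norm_num)

/-- **the genus-4 septic Jacobians over `(0; 3A,3A,3A,3A,3B)` and `(0; 3A,3B,3B,3B,3B)` (genus 15; one orbit of 11970 tuples each; 2 parameters): `K`-signature `(2,2)`, `det H = 23328/2401 = (54/49)² + 7·(54/49)²` — row `W4.7.1` (split); `SU(2,2)` dense (15/15).**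
research route conditional on HC_CM; not a corollary; Q11.4-sentence-2 already refuted in dim ≥ 3. [cite: vanGeemen1994HodgeAV, (5.4.1)] -/
theorem septicJacobian_f21_3A4_3B_mk_detH_eq_split :
    (QuotientGroup.mk (Units.mk0 ((23328 : ℚ) / 2401) (by norm_num)) : weilNormResidueGroup 7) =
      splitDiscriminantClass 2 7 := by
  rw [mk_eq_splitDiscriminantClass_iff_of_even (n := 2) (by decide)]
  exact mem_normUnitsSubgroup_of_sq_add_mul_sq _ ((54 : ℚ) / 49) ((54 : ℚ) / 49) (by norm_num)

/-- **the Pryms `P(D_t/E_t)` (`dim 4`, `g(D_t) = 5`) over `(1; 3,3′)` (genus 15; one orbit of 6048 tuples; 2 parameters): `K`-signature `(2,2)`, `det H = 18 = (3/2)² + 7·(3/2)²` (unique invariant form, sign immaterial for even `K`-dimension) — row `W4.7.1` (split); `SU(2,2)` dense (15/15).**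
research route conditional on HC_CM; not a corollary; Q11.4-sentence-2 already refuted in dim ≥ 3. [cite: vanGeemen1994HodgeAV, (5.4.1)] -/
theorem septicPrym_f21_g1_33_mk_detH_eq_split :
    (QuotientGroup.mk (Units.mk0 (18 : ℚ) (by norm_num)) : weilNormResidueGroup 7) =
      splitDiscriminantClass 2 7 := by
  rw [mk_eq_splitDiscriminantClass_iff_of_even (n := 2) (by decide)]
  exact mem_normUnitsSubgroup_of_sq_add_mul_sq _ ((3 : ℚ) / 2) ((3 : ℚ) / 2) (by norm_num)

/-- **the `η`-factor `B_t` (`dim 4`) of the `PSL₂(𝔽₇)`-covers `(0; 2,2,7,7′)` (genus 61; one orbit of 28224 tuples): `K`-signature `(2,2)`, `det H = 81/175616 = (9/448)² + 7·(9/3136)²` — row `W4.7.1` (split); here the monodromy is NOT dense: `𝔰𝔭₄` (10/15), commutant `M₂(ℚ)`, `B_t ~ S_t²`, `P_t ~ S_t⁶`.**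
research route conditional on HC_CM; not a corollary; Q11.4-sentence-2 already refuted in dim ≥ 3. [cite: vanGeemen1994HodgeAV, (5.4.1)] -/
theorem fourfold_psl27_2277_mk_detH_eq_split :
    (QuotientGroup.mk (Units.mk0 ((81 : ℚ) / 175616) (by norm_num)) : weilNormResidueGroup 7) =
      splitDiscriminantClass 2 7 := by
  rw [mk_eq_splitDiscriminantClass_iff_of_even (n := 2) (by decide)]
  exact mem_normUnitsSubgroup_of_sq_add_mul_sq _ ((9 : ℚ) / 448) ((9 : ℚ) / 3136) (by norm_num)

/-- **the genus-2 septic Jacobians over `(0; 3A,3A,3B,3B)` (genus 8; one orbit of 2016 tuples): abelian SURFACES with `(1,1)` `ℚ(√-7)`-action, `det H = −72/49`, `a = 72/49 = (3/7)² + 7·(3/7)²` — class `[1]` (the `E²`-locus: commutant `(−7, 1/28)_ℚ ≅ M₂(ℚ)`, `B_t ~ E_t²`, `P_t ~ E_t⁶`).**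
research route conditional on HC_CM; not a corollary; Q11.4-sentence-2 already refuted in dim ≥ 3. [cite: vanGeemen1994HodgeAV, (5.4.1)] -/
theorem septicJacobian_f21_3A3A3B3B_mk_detH_eq_split :
    (QuotientGroup.mk (Units.mk0 ((-72 : ℚ) / 49) (by norm_num)) : weilNormResidueGroup 7) =
      splitDiscriminantClass 1 7 := by
  have e : Units.mk0 ((-72 : ℚ) / 49) (by norm_num) = -(Units.mk0 ((72 : ℚ) / 49) (by norm_num)) :=
    Units.ext (by norm_num)
  rw [e, mk_neg_eq_splitDiscriminantClass_iff_of_odd (n := 1) (by decide)]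
  exact mem_normUnitsSubgroup_of_sq_add_mul_sq _ ((3 : ℚ) / 7) ((3 : ℚ) / 7) (by norm_num)

/-- **the `η`-factor `B_t` (`dim 2`) of the `PSL₂(𝔽₇)`-covers `(0; 2,2,3,3)` (genus 29; one orbit of 30240 tuples — ring2-b04's «(3,3) Weil sixfold family» is `B_t³`): `det H = −9/686`, `a = 9/686 = (3/28)² + 7·(3/196)²` — class `[1]`; monodromy dense in `SL₂`, commutant `(−7,1/7)_ℚ ≅ M₂(ℚ)`: `B_t ~ E_t²`, `P_t ~ E_t⁶`.**
research route conditional on HC_CM; not a corollary; Q11.4-sentence-2 already refuted in dim ≥ 3. [cite: vanGeemen1994HodgeAV, (5.4.1)] -/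
theorem surface_psl27_2233_mk_detH_eq_split :
    (QuotientGroup.mk (Units.mk0 ((-9 : ℚ) / 686) (by norm_num)) : weilNormResidueGroup 7) =
      splitDiscriminantClass 1 7 := by
  have e : Units.mk0 ((-9 : ℚ) / 686) (by norm_num) = -(Units.mk0 ((9 : ℚ) / 686) (by norm_num)) :=
    Units.ext (by norm_num)
  rw [e, mk_neg_eq_splitDiscriminantClass_iff_of_odd (n := 1) (by decide)]
  exact mem_normUnitsSubgroup_of_sq_add_mul_sq _ ((3 : ℚ) / 28) ((3 : ℚ) / 196) (by norm_num)

/-- **the `η`-factor (`dim 2`) over `(0; 2,2,3,4)` (genus 36): `det H = −9/784 = −(3/28)²` — class `[1]`; `P_t ~ E_t⁶`.**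
research route conditional on HC_CM; not a corollary; Q11.4-sentence-2 already refuted in dim ≥ 3. [cite: vanGeemen1994HodgeAV, (5.4.1)] -/
theorem surface_psl27_2234_mk_detH_eq_split :
    (QuotientGroup.mk (Units.mk0 ((-9 : ℚ) / 784) (by norm_num)) : weilNormResidueGroup 7) =
      splitDiscriminantClass 1 7 := by
  have e : Units.mk0 ((-9 : ℚ) / 784) (by norm_num) = -(Units.mk0 ((9 : ℚ) / 784) (by norm_num)) :=
    Units.ext (by norm_num)
  rw [e, mk_neg_eq_splitDiscriminantClass_iff_of_odd (n := 1) (by decide)]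
  exact mem_normUnitsSubgroup_of_sq_add_mul_sq _ ((3 : ℚ) / 28) (0 : ℚ) (by norm_num)

/-- **the `η`-factor (`dim 2`) over `(0; 2,2,4,4)` (genus 43): `det H = −9/1372`, `a = 0² + 7·(3/98)²` — class `[1]`; `P_t ~ E_t⁶`.**
research route conditional on HC_CM; not a corollary; Q11.4-sentence-2 already refuted in dim ≥ 3. [cite: vanGeemen1994HodgeAV, (5.4.1)] -/
theorem surface_psl27_2244_mk_detH_eq_split :
    (QuotientGroup.mk (Units.mk0 ((-9 : ℚ) / 1372) (by norm_num)) : weilNormResidueGroup 7) =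
      splitDiscriminantClass 1 7 := by
  have e : Units.mk0 ((-9 : ℚ) / 1372) (by norm_num) = -(Units.mk0 ((9 : ℚ) / 1372) (by norm_num)) :=
    Units.ext (by norm_num)
  rw [e, mk_neg_eq_splitDiscriminantClass_iff_of_odd (n := 1) (by decide)]
  exact mem_normUnitsSubgroup_of_sq_add_mul_sq _ (0 : ℚ) ((3 : ℚ) / 98) (by norm_num)

/-- **the `η`-factor (`dim 2`) over `(0; 2,3,3,3)` (genus 43): `det H = −9/2744`, `a = (3/56)² + 7·(3/392)²` — class `[1]`; `P_t ~ E_t⁶`.**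
research route conditional on HC_CM; not a corollary; Q11.4-sentence-2 already refuted in dim ≥ 3. [cite: vanGeemen1994HodgeAV, (5.4.1)] -/
theorem surface_psl27_2333_mk_detH_eq_split :
    (QuotientGroup.mk (Units.mk0 ((-9 : ℚ) / 2744) (by norm_num)) : weilNormResidueGroup 7) =
      splitDiscriminantClass 1 7 := by
  have e : Units.mk0 ((-9 : ℚ) / 2744) (by norm_num) = -(Units.mk0 ((9 : ℚ) / 2744) (by norm_num)) :=
    Units.ext (by norm_num)
  rw [e, mk_neg_eq_splitDiscriminantClass_iff_of_odd (n := 1) (by decide)]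
  exact mem_normUnitsSubgroup_of_sq_add_mul_sq _ ((3 : ℚ) / 56) ((3 : ℚ) / 392) (by norm_num)

/-- **the `η`-factor (`dim 2`) of the RIGID `PSL₂(𝔽₇)`-curves `(0; 3,7,7′)` (genus 33) and `(0; 4,7,7′)` (genus 40; both braid orbits): `det H = −9/112`, `a = 0² + 7·(3/28)²` — class `[1]`; `P = B³` with `B` one abelian surface (HC for all powers in print, whatever `B` is).**
research route conditional on HC_CM; not a corollary; Q11.4-sentence-2 already refuted in dim ≥ 3. [cite: vanGeemen1994HodgeAV, (5.4.1)] -/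
theorem surface_psl27_rigid_377_477_mk_detH_eq_split :
    (QuotientGroup.mk (Units.mk0 ((-9 : ℚ) / 112) (by norm_num)) : weilNormResidueGroup 7) =
      splitDiscriminantClass 1 7 := by
  have e : Units.mk0 ((-9 : ℚ) / 112) (by norm_num) = -(Units.mk0 ((9 : ℚ) / 112) (by norm_num)) :=
    Units.ext (by norm_num)
  rw [e, mk_neg_eq_splitDiscriminantClass_iff_of_odd (n := 1) (by decide)]
  exact mem_normUnitsSubgroup_of_sq_add_mul_sq _ (0 : ℚ) ((3 : ℚ) / 28) (by norm_num)

/-- The class of the genus-6 septic Jacobians `(0; 3,3,3,7,7′)` stated positively: `a = 7·(1944/343)² ∈ Nm(ℚ(√-7)ˣ)` —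
the component of these Jacobians is the one containing the hyperbolic members `E_K³ × Ē_K³` (Landherr / van Geemen
(5.4.1), tree: `VanGeemen1994.isHyperbolicWeilType_iff_hasWeilDiscriminantNondeg_split`).
research route conditional on HC_CM; not a corollary; Q11.4-sentence-2 already refuted in dim ≥ 3. [cite: vanGeemen1994HodgeAV, (5.4.1)] -/
theorem septicJacobian_f21_33377_a_mem_norm :
    Units.mk0 ((3779136 : ℚ) / 16807) (by norm_num) ∈ normUnitsSubgroup ℚ (weilField 7) :=
  mem_normUnitsSubgroup_of_sq_add_mul_sq _ (0 : ℚ) ((1944 : ℚ) / 343) (by norm_num)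

end Summit.HodgeConjecture.HodgeConjecture.Ring2.WeilCoverage

end
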